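import Summits.QuantumFields.BalabanUV.Beta.EriceRemainderEnclosureHistoryAutonomyComparisonDualConcaveGauge

/-!
# EriceRemainderEnclosureHistoryAutonomyComparisonDualConcave — (E136c) **COMPARISON AT ANY SIZE FOR EVERY ISOTONE EXCESS OVER EVERY SEPARABLE CONCAVE MEMORY.**
# `B u = β₀ + Σ_{k<K} f_k(u_k)` on the box ]0,γ] with `β₀ > 0` and, for every age, `f_k ≥ 0` NON-DECREASING, `f_k(u)∕u` NON-INCREASING, `f_k` CONCAVE on ]0,γ]; `B` with a
# zeroth moment; `B′ ≥ B` with a zeroth moment and ISOTONE excess (no modulus, steepness, size or threshold condition); `h`, `h′` ANY box solutions of `B`, `B′` from one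
# pin.  **`le_of_isotone_excess_concave`**: `h′ ≤ h` at EVERY scale.  The affine memory of (E135b) `le_of_isotone_excess_affine` is the boundary case `f_k(u) = L_k u`; the
# hinge memory of (E56a)∕(E56b) (isotone, with a zeroth moment, comparison FAILS for a constant excess beyond the threshold `3√3`) is exactly NON-concave — so within
# separable isotone memories the comparison class is bracketed by concavity.  PROOF: the dual orbit gauge of (E132)–(E135) with chord-slope weights: §1 **`concave_deep_step`**
# (the base of the induction at a deep pin `M·h′_{n+1} ≤ b`: window through the source, `E_{n+1} − X′_{n+1} = B(tail_1 S h′_{n+1}) − B(tail_{n+2}h′) ≤ M·E_{n+1}h′_{n+1}∕(2b)` by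
# the modulus and `(1+j)·x²_{1+j} ≤ 1∕b`); §2 **`concave_steps_nonneg_gauge`** (induction from (E135b) `exists_depth` with `C₀ = (M∕b)³`, step (E136b) `concave_gauge_step`) and
# the family-free END by (E39)∕(E43b) and (E132) `cmp_of_dual_steps_nonneg`.

Cell `pub-balaban`, β-function sub-cell, BINDER row D4 «RemainderConst leaves for Bałaban's split» (`HOME/BINDER-OWNERS.md`; owner lineage `b2b-balaban-beta-an4`;
this file by co-owner #2 lineage `b2b-balaban-beta-d4-p2`, generation 104), β-FLOW TEAM duty (1), FREEZE (0) honoured (def-free; imports (E136b); uses (E136a∕b)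
`chord_slope_facts` ∕ `concave_row_ge` ∕ `concave_step_le_excess` ∕ `concave_gauge_step`, (E135a∕b) `gauge_of_row` ∕ `level_ge_floor` ∕ `exists_depth`, (E134)
`steps_mul_le_rise` ∕ `cmp_from_pin` ∕ `source_chain` ∕ `pert_step_le_level`, (E133) `coupling_gap_le` ∕ `dual_two_pin_le`, (E132) `dual_source_antitone` ∕
`dual_gap_le_sum_steps` ∕ `cmp_of_dual_steps_nonneg`, (E39) `exists_memFlow_zm`, (E43b) `memFlow_unique_of_monotone_zm`, (E48a) `family_zero` ∕ `strictAnti_of_memFlow` BY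
NAME; nothing restated).

HONEST FRAMING (page 1, verbatim and binding).  *"Discharging BetaPertH makes Bałaban's UV stability UNCONDITIONAL — a real constructive-QFT result; it is
NOT the continuum limit and NOT the Clay problem."*  THIS FILE DISCHARGES NOTHING OF THE KIND.  Elementary real analysis about ABSTRACT functionals on a box
]0,γ]^ℕ with displayed floor, profiles and signs — hypotheses of a census, not facts; the form, signs, ages, moments and convexity of Bałaban's (1.22) limit functional
are NOT PRINTED ([I] p. 298; GAPS G-t4-U2-1∕-2) and NOT asserted.  Row D4 class UNCHANGED (critical-path width 0; instance 0∕1; D4 DISCHARGE NO DATE).  HONEST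
DEPENDENCY: continuum YM on T⁴ ⇐ BetaPertH ∧ nine spine estimates (0/9 proved); BetaPertH ⇐ (D1) ∧ (D4) ∧ CAP+tail.  NOT B12 Thm 2, NOT BetaPertH, NOT continuum, NOT Clay.

WHAT IS PROVED ([folklore]; 0 `def`, 0 sorry).  §1 **`concave_deep_step`**.  §2 **`concave_steps_nonneg_gauge`**, **`le_of_isotone_excess_concave`**.
-/

noncomputable section
open Finset Set

namespace Summit.QuantumFields.BalabanUV.Beta.EriceRemainderEnclosureHistoryAutonomyComparisonDualConcave

open Literature.MathematicalPhysics.QuantumFieldTheory.Balaban1983to89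
open Literature.MathematicalPhysics.QuantumFieldTheory.Balaban1983to89.T4BetaStationary
open Literature.MathematicalPhysics.QuantumFieldTheory.Balaban1983to89.T4BetaFlowWellPosed
open Summit.QuantumFields.BalabanUV.Beta.EriceRemainderEnclosureHistoryAutonomyOrder
  (family_zero family_mem family_tail_eq family_succ_eq le_of_pin_le strictAnti_of_memFlow)
open Summit.QuantumFields.BalabanUV.Beta.EriceRemainderEnclosureHistoryAutonomyComparisonDualOrbit
  (dual_source_antitone dual_gap_le_sum_steps cmp_of_dual_steps_nonneg)
open Summit.QuantumFields.BalabanUV.Beta.EriceRemainderEnclosureHistoryAutonomyComparisonDualRow (coupling_gap_le dual_two_pin_le)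
open Summit.QuantumFields.BalabanUV.Beta.EriceRemainderEnclosureHistoryAutonomyComparisonDualGauge
  (steps_mul_le_rise cmp_from_pin source_chain pert_step_le_level)
open Summit.QuantumFields.BalabanUV.Beta.EriceRemainderEnclosureHistoryAutonomyComparisonDualDeep (gauge_of_row)
open Summit.QuantumFields.BalabanUV.Beta.EriceRemainderEnclosureHistoryAutonomyComparisonDualComparison (level_ge_floor exists_depth)
open Summit.QuantumFields.BalabanUV.Beta.EriceRemainderEnclosureHistoryAutonomyComparisonDualConcaveRow (chord_slope_facts concave_row_ge)
open Summit.QuantumFields.BalabanUV.Beta.EriceRemainderEnclosureHistoryAutonomyComparisonDualConcaveGauge (concave_step_le_excess concave_gauge_step)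

variable {B B' : (ℕ → ℝ) → ℝ} {M γ b β₀ : ℝ} {f : ℕ → ℝ → ℝ} {K : ℕ} {S : ℝ → ℕ → ℝ} {h' : ℕ → ℝ}

/-! ## §1 The gauge in the deep region (separable concave memory) -/

set_option maxHeartbeats 800000 in
/-- **THE GAUGE IN THE DEEP REGION FOR SEPARABLE CONCAVE MEMORY.**  Setting of (E136b) `concave_gauge_step`; the dual steps are known non-negative from row `n` on and the
pin is DEEP, `M·h′_{n+1} ≤ b` (`M` the modulus of `B`, `b` its floor).  Then `g_{n+1} ≤ g_n` — (E135a) `deep_step` with the chord slopes: the window through the source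
(`δ_k ≤ k·E_{n+1}`), `E_{n+1} − X′_{n+1} = B(tail_1 S h′_{n+1}) − B(tail_{n+2}h′) ≤ M·E_{n+1}h′_{n+1}∕(2b) ≤ E_{n+1}∕2` (modulus; coupling gaps `≤ δ·x²w∕2`, `(1+j)·x²_{1+j} ≤ 1∕b`),
deficit `≤ g_{n+1}·λ_k x_k∕2`, first entry `≤ λ_k x_k∕2` per unit `h′_n²`, share `λ_k x_k ≤ f_k(x_k) ≤ f_k((S h′_n)_{1+k})`. [folklore] -/
theorem concave_deep_step (hBf : ∀ u, SeqBox γ u → B u = β₀ + ∑ k ∈ range K, f k (u k)) (hβ : 0 < β₀)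
    (hf0 : ∀ k a, 0 < a → a ≤ γ → 0 ≤ f k a) (hfratio : ∀ k a c, 0 < a → a ≤ c → c ≤ γ → f k c * a ≤ f k a * c)
    (hfconc : ∀ k a c d e, 0 < a → a < c → 0 < d → d < e → a ≤ d → c ≤ e → e ≤ γ → (f k e - f k d) * (c - a) ≤ (f k c - f k a) * (e - d))
    (hfmono : ∀ k a c, 0 < a → a ≤ c → c ≤ γ → f k a ≤ f k c)
    (hb : 0 < b)
    (hmono : ∀ u v : ℕ → ℝ, SeqBox γ u → SeqBox γ v → (∀ i, u i ≤ v i) → B u ≤ B v)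
    (hB : ∀ u u' : ℕ → ℝ, SeqBox γ u → SeqBox γ u' → ∀ D : ℝ, (∀ j, |u j - u' j| ≤ D) → |B u - B u'| ≤ M * D) (hM : 0 ≤ M)
    (hlo : ∀ u, SeqBox γ u → b ≤ B u)
    (hS : ∀ p, 0 < p → p ≤ γ → SeqBox γ (S p) ∧ MemFlow B p (S p))
    (huniq : ∀ p, 0 < p → p ≤ γ → ∀ u u' : ℕ → ℝ, SeqBox γ u → SeqBox γ u' → MemFlow B p u → MemFlow B p u' → u = u')
    (hexc : ∀ u, SeqBox γ u → B u ≤ B' u)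
    (hDmono : ∀ u v : ℕ → ℝ, SeqBox γ u → SeqBox γ v → (∀ i, u i ≤ v i) → B' u - B u ≤ B' v - B v)
    (hh' : SeqBox γ h') {y : ℝ} (hf' : MemFlow B' y h') (n : ℕ)
    (hX0 : 0 ≤ B' (fun i => h' (n + 1 + i)) - B (fun i => S (h' n) (1 + i)))
    (hXup : ∀ l, 0 ≤ B' (fun i => h' (n + 1 + l + 1 + i)) - B (fun i => S (h' (n + 1 + l)) (1 + i)))
    (hdeep : M * h' (n + 1) ≤ b) :
    (B' (fun i => h' (n + 1 + 1 + i)) - B (fun i => S (h' (n + 1)) (1 + i))) * h' (n + 1) ^ 2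
      ≤ (B' (fun i => h' (n + 1 + i)) - B (fun i => S (h' n) (1 + i))) * h' n ^ 2 := by
  -- derived facts
  have hmono' : ∀ u v : ℕ → ℝ, SeqBox γ u → SeqBox γ v → (∀ i, u i ≤ v i) → B' u ≤ B' v := fun u v hu hv hle => by
    linarith [hmono u v hu hv hle, hDmono u v hu hv hle]
  have hlo' : ∀ u, SeqBox γ u → b ≤ B' u := fun u hu => (hlo u hu).trans (hexc u hu)
  have hanti : Antitone h' := (strictAnti_of_memFlow hb hlo' hh' hf').antitone
  have hpos : ∀ j, 0 < h' j := fun j => (hh' j).1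
  have hcmp : ∀ l, h' (n + 1 + l) ≤ S (h' (n + 1)) l := cmp_from_pin (B' := B') hb hB hM hlo hS huniq hh' hf' (n + 1) hXup
  have hp1 := hh' (n + 1)
  have hpn := hh' n
  have hS1 := hS (h' (n + 1)) hp1.1 hp1.2
  have hSn := hS (h' n) hpn.1 hpn.2
  have hxpos : ∀ k, 0 < S (h' (n + 1)) k := fun k => (hS1.1 k).1
  have hx0 : S (h' (n + 1)) 0 = h' (n + 1) := family_zero hS hp1.1 hp1.2
  have hxanti' := strictAnti_of_memFlow hb hlo hS1.1 hS1.2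
  have hxanti := hxanti'.antitone
  have hσanti := (strictAnti_of_memFlow hb hlo hSn.1 hSn.2).antitone
  have hxle0 : ∀ k, S (h' (n + 1)) k ≤ h' (n + 1) := fun k => by have := hxanti (Nat.zero_le k); rwa [hx0] at this
  set X0 : ℝ := B' (fun i => h' (n + 1 + i)) - B (fun i => S (h' n) (1 + i)) with hX0def
  set X1 : ℝ := B' (fun i => h' (n + 1 + 1 + i)) - B (fun i => S (h' (n + 1)) (1 + i)) with hX1def
  set E1 : ℝ := B' (fun i => h' (n + 1 + 1 + i)) - B (fun i => h' (n + 1 + 1 + i)) with hE1def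
  set u0 : ℝ := h' n ^ 2 with hu0
  set u1 : ℝ := h' (n + 1) ^ 2 with hu1
  set lam : ℕ → ℝ := fun k => (f k (S (h' (n + 1)) k) - f k (S (h' (n + 1)) (k + 1))) / (S (h' (n + 1)) k - S (h' (n + 1)) (k + 1)) with hlamdef
  have hlamk : ∀ k, 0 ≤ lam k ∧ lam k * S (h' (n + 1)) (k + 1) ≤ f k (S (h' (n + 1)) (k + 1)) ∧ lam k * S (h' (n + 1)) k ≤ f k (S (h' (n + 1)) k) := by
    intro k
    have hxpx : S (h' (n + 1)) (k + 1) < S (h' (n + 1)) k := hxanti' (Nat.lt_succ_self k)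
    have hxγ : S (h' (n + 1)) k ≤ γ := (hS1.1 k).2
    exact chord_slope_facts hxpx (hfmono k _ _ (hxpos (k + 1)) hxpx.le hxγ) (hfratio k _ _ (hxpos (k + 1)) hxpx.le hxγ)
  have hu0p : 0 < u0 := pow_pos (hpos n) 2
  have hu1p : 0 < u1 := pow_pos (hpos (n + 1)) 2
  have hu10 : u1 ≤ u0 := pow_le_pow_left₀ (hpos _).le (hanti (Nat.le_succ n)) 2
  have hX1nn : 0 ≤ X1 := by have := hXup 0; simp only [Nat.add_zero] at this; exact this
  have hlev0 : X0 = 1 / h' (n + 1) ^ 2 - 1 / h' n ^ 2 - B (fun i => S (h' n) (1 + i)) := by rw [hX0def, hf'.2 n]; ring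
  have hlev1 : B' (fun i => h' (n + 1 + 1 + i)) = 1 / h' (n + 1 + 1) ^ 2 - 1 / h' (n + 1) ^ 2 := by rw [hf'.2 (n + 1)]; ring
  have hΦ00 : B (fun i => S (h' (n + 1)) (1 + i)) ≤ 1 / u1 := by
    have h1 : B (fun i => S (h' (n + 1)) (1 + i)) ≤ B' (fun i => h' (n + 1 + 1 + i)) := by linarith [hX1nn]
    have h2 := pert_step_le_level hmono' hb hlo' hh' hf' (m := n + 1) (by omega)
    rw [hlev1] at h1; simp only [hu1]; linarith
  -- every dual step from row n+1 on is at most the excess there, hence at most E1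
  have hXE : ∀ l, B' (fun i => h' (n + 1 + l + 1 + i)) - B (fun i => S (h' (n + 1 + l)) (1 + i)) ≤ E1 := by
    intro l
    have hcl : ∀ q, h' (n + 1 + l + q) ≤ S (h' (n + 1 + l)) q :=
      cmp_from_pin (B' := B') hb hB hM hlo hS huniq hh' hf' (n + 1 + l) (fun q => by
        have := hXup (l + q); rw [show n + 1 + (l + q) = n + 1 + l + q by ring] at this; exact this)
    have h1 := concave_step_le_excess (B' := B') hBf hfmono hS hh' (n + 1 + l) hcl
    have h2 := source_chain (B := B) (B' := B') hDmono hh' hanti (n + 1) l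
    exact h1.trans h2
  have hE1nn : 0 ≤ E1 := hX1nn.trans (by have := hXE 0; simp only [Nat.add_zero] at this; exact this)
  have hwin : ∀ k, 1 / h' (n + 1 + k) ^ 2 - 1 / S (h' (n + 1)) k ^ 2 ≤ (k : ℝ) * E1 := by
    intro k
    obtain ⟨_, hsum⟩ := dual_gap_le_sum_steps (B' := B') hb hmono hB hM hlo hS huniq hh' hf' (n + 1) k (fun l _ => hXup l)
    have := hsum.trans (sum_le_sum fun l _ => hXE l)
    rwa [sum_const, card_range, nsmul_eq_mul] at this
  -- the excess at the deep pin is at most twice the dual step: E1 − X1 = B(tail_1 S h′_{n+1}) − B(tail_{n+2} h′) ≤ M·E1·h′_{n+1}/(2b)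
  have hlevS := level_ge_floor hb hlo hS1.1 hS1.2
  have hE2 : E1 ≤ 2 * X1 := by
    have hD : ∀ j, |S (h' (n + 1)) (1 + j) - h' (n + 1 + 1 + j)| ≤ E1 * h' (n + 1) / (2 * b) := by
      intro j
      have hx := hxpos (1 + j)
      have hw : 0 < h' (n + 1 + 1 + j) := hpos _
      have hcc : h' (n + 1 + 1 + j) ≤ S (h' (n + 1)) (1 + j) := by
        have := hcmp (1 + j); rwa [show n + 1 + (1 + j) = n + 1 + 1 + j by ring] at this
      rw [abs_of_nonneg (by linarith)]
      have hgap := coupling_gap_le hw hcc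
      have hδ := hwin (1 + j)
      rw [show n + 1 + (1 + j) = n + 1 + 1 + j by ring] at hδ
      -- (1+j)·x² ≤ 1/b
      have hl := hlevS (1 + j)
      have hjx : (((1 + j : ℕ) : ℝ)) * S (h' (n + 1)) (1 + j) ^ 2 ≤ 1 / b := by
        rw [le_div_iff₀ hb]
        have := mul_le_mul_of_nonneg_left hl (pow_pos hx 2).le
        rw [mul_one_div_cancel (pow_pos hx 2).ne'] at this
        nlinarith [this]
      have h1 : (1 / h' (n + 1 + 1 + j) ^ 2 - 1 / S (h' (n + 1)) (1 + j) ^ 2) * (S (h' (n + 1)) (1 + j) ^ 2 * h' (n + 1 + 1 + j) / 2)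
          ≤ (((1 + j : ℕ) : ℝ) * E1) * (S (h' (n + 1)) (1 + j) ^ 2 * S (h' (n + 1)) (1 + j) / 2) :=
        mul_le_mul hδ (by nlinarith [mul_le_mul_of_nonneg_left hcc (sq_nonneg (S (h' (n + 1)) (1 + j)))]) (by positivity) (by positivity)
      have h2 : (((1 + j : ℕ) : ℝ) * E1) * (S (h' (n + 1)) (1 + j) ^ 2 * S (h' (n + 1)) (1 + j) / 2) ≤ E1 * h' (n + 1) / (2 * b) := by
        have e : (((1 + j : ℕ) : ℝ) * E1) * (S (h' (n + 1)) (1 + j) ^ 2 * S (h' (n + 1)) (1 + j) / 2)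
            = E1 * ((((1 + j : ℕ) : ℝ)) * S (h' (n + 1)) (1 + j) ^ 2) * S (h' (n + 1)) (1 + j) / 2 := by ring
        rw [e, div_le_div_iff₀ (by norm_num) (by positivity)]
        have := mul_le_mul hjx (hxle0 (1 + j)) hx.le (by positivity)
        have key : (((1 + j : ℕ) : ℝ)) * S (h' (n + 1)) (1 + j) ^ 2 * S (h' (n + 1)) (1 + j) * b ≤ h' (n + 1) := by
          have h3 := mul_le_mul_of_nonneg_right this hb.le
          have e3 : 1 / b * h' (n + 1) * b = h' (n + 1) := by field_simp
          rw [e3] at h3; exact h3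
        nlinarith [mul_le_mul_of_nonneg_left key hE1nn]
      linarith [hgap, h1, h2]
    have hmod := hB (fun i => S (h' (n + 1)) (1 + i)) (fun i => h' (n + 1 + 1 + i)) (fun i => hS1.1 (1 + i)) (fun i => hh' _) _ hD
    have hdrop : B (fun i => S (h' (n + 1)) (1 + i)) - B (fun i => h' (n + 1 + 1 + i)) ≤ M * (E1 * h' (n + 1) / (2 * b)) := (le_abs_self _).trans hmod
    have hhalf : M * (E1 * h' (n + 1) / (2 * b)) ≤ E1 / 2 := by
      rw [show M * (E1 * h' (n + 1) / (2 * b)) = (M * h' (n + 1)) * E1 / (2 * b) by ring, div_le_div_iff₀ (by positivity) (by norm_num)]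
      nlinarith [mul_le_mul_of_nonneg_right hdeep hE1nn]
    have e : E1 - X1 = B (fun i => S (h' (n + 1)) (1 + i)) - B (fun i => h' (n + 1 + 1 + i)) := by rw [hE1def, hX1def]; ring
    linarith
  -- the row inequality and the deficit through the source window
  have hrow := concave_row_ge (B' := B') hBf hβ.le hf0 hfratio hfconc hfmono hb hmono hB hM hlo hS huniq hlo' hDmono hh' hf' n hcmp hXup
  rw [max_eq_left hX0] at hrow
  set C : ℝ := ∑ k ∈ range K, lam k * (S (h' (n + 1)) k / 2) with hC
  have hdef : ∑ k ∈ range K, lam k * (S (h' (n + 1)) k ^ 3 * (1 / S (h' (n + 1)) (k + 1) ^ 2 - 1 / S (h' (n + 1)) k ^ 2)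
        * (h' (n + 1 + k) ^ 2 * (1 / h' (n + 1 + k) ^ 2 - 1 / S (h' (n + 1)) k ^ 2))) ≤ X1 * u1 * C := by
    rw [hC, mul_sum]
    refine sum_le_sum fun k _ => ?_
    have hxk := hxpos k
    have hrise := steps_mul_le_rise hmono hb hlo hS1.1 hS1.2 k
    rw [hx0] at hrise
    have hΦk : 0 ≤ 1 / S (h' (n + 1)) (k + 1) ^ 2 - 1 / S (h' (n + 1)) k ^ 2 := by
      rw [hS1.2.2 k]; linarith [hlo _ (seqBox_shift hS1.1 (k + 1))]
    have hwk : h' (n + 1 + k) ≤ S (h' (n + 1)) k := hcmp k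
    have hw0 : 0 < h' (n + 1 + k) := hpos _
    have hwδ : h' (n + 1 + k) ^ 2 * (1 / h' (n + 1 + k) ^ 2 - 1 / S (h' (n + 1)) k ^ 2) ≤ S (h' (n + 1)) k ^ 2 * ((k : ℝ) * (2 * X1)) := by
      have hδ0 : 0 ≤ 1 / h' (n + 1 + k) ^ 2 - 1 / S (h' (n + 1)) k ^ 2 :=
        sub_nonneg.mpr (one_div_le_one_div_of_le (pow_pos hw0 2) (pow_le_pow_left₀ hw0.le hwk 2))
      have h1 : (k : ℝ) * E1 ≤ (k : ℝ) * (2 * X1) := mul_le_mul_of_nonneg_left hE2 (Nat.cast_nonneg k)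
      exact mul_le_mul (pow_le_pow_left₀ hw0.le hwk 2) ((hwin k).trans h1) hδ0 (by positivity)
    have step1 : S (h' (n + 1)) k ^ 3 * (1 / S (h' (n + 1)) (k + 1) ^ 2 - 1 / S (h' (n + 1)) k ^ 2)
        * (h' (n + 1 + k) ^ 2 * (1 / h' (n + 1 + k) ^ 2 - 1 / S (h' (n + 1)) k ^ 2))
        ≤ S (h' (n + 1)) k ^ 3 * (1 / S (h' (n + 1)) (k + 1) ^ 2 - 1 / S (h' (n + 1)) k ^ 2) * (S (h' (n + 1)) k ^ 2 * ((k : ℝ) * (2 * X1))) :=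
      mul_le_mul_of_nonneg_left hwδ (by positivity)
    have step2 : S (h' (n + 1)) k ^ 5 * ((k : ℝ) * (1 / S (h' (n + 1)) (k + 1) ^ 2 - 1 / S (h' (n + 1)) k ^ 2))
        ≤ S (h' (n + 1)) k ^ 5 * (1 / S (h' (n + 1)) k ^ 2 - 1 / h' (n + 1) ^ 2) :=
      mul_le_mul_of_nonneg_left hrise (by positivity)
    have e3 : S (h' (n + 1)) k ^ 5 * (1 / S (h' (n + 1)) k ^ 2 - 1 / h' (n + 1) ^ 2)
        = u1 * S (h' (n + 1)) k * ((S (h' (n + 1)) k ^ 2 / u1) * (1 - S (h' (n + 1)) k ^ 2 / u1)) := by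
      have hne : h' (n + 1) ≠ 0 := (hpos _).ne'
      simp only [hu1]; field_simp
    have hq : (S (h' (n + 1)) k ^ 2 / u1) * (1 - S (h' (n + 1)) k ^ 2 / u1) ≤ 1 / 4 := by
      nlinarith [sq_nonneg (S (h' (n + 1)) k ^ 2 / u1 - 1 / 2)]
    have step3 : S (h' (n + 1)) k ^ 5 * (1 / S (h' (n + 1)) k ^ 2 - 1 / h' (n + 1) ^ 2) ≤ u1 * S (h' (n + 1)) k * (1 / 4) := by
      rw [e3]; exact mul_le_mul_of_nonneg_left hq (by positivity)
    have step4 := mul_le_mul_of_nonneg_left (step2.trans step3) (by positivity : (0 : ℝ) ≤ 2 * X1)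
    have hk : S (h' (n + 1)) k ^ 3 * (1 / S (h' (n + 1)) (k + 1) ^ 2 - 1 / S (h' (n + 1)) k ^ 2)
        * (h' (n + 1 + k) ^ 2 * (1 / h' (n + 1 + k) ^ 2 - 1 / S (h' (n + 1)) k ^ 2)) ≤ X1 * u1 * (S (h' (n + 1)) k / 2) :=
      calc _ ≤ S (h' (n + 1)) k ^ 3 * (1 / S (h' (n + 1)) (k + 1) ^ 2 - 1 / S (h' (n + 1)) k ^ 2) * (S (h' (n + 1)) k ^ 2 * ((k : ℝ) * (2 * X1))) := step1
        _ = 2 * X1 * (S (h' (n + 1)) k ^ 5 * ((k : ℝ) * (1 / S (h' (n + 1)) (k + 1) ^ 2 - 1 / S (h' (n + 1)) k ^ 2))) := by ring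
        _ ≤ 2 * X1 * (u1 * S (h' (n + 1)) k * (1 / 4)) := step4
        _ = X1 * u1 * (S (h' (n + 1)) k / 2) := by ring
    have := mul_le_mul_of_nonneg_left hk (hlamk k).1
    linarith [this]
  -- u1·C < 1:  λ_k x_k ≤ f_k(x_k) ≤ 2 f_k(x_{k+1}) and u1·Σ f_k(x_{k+1}) ≤ 1 − u1 β₀
  have hC1 : u1 * C < 1 := by
    have hle : C ≤ ∑ k ∈ range K, f k (S (h' (n + 1)) (1 + k)) := by
      rw [hC]
      refine sum_le_sum fun k _ => ?_
      obtain ⟨hl0, _, hlx⟩ := hlamk k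
      have hxk := hxpos k
      have hxk1 := hxpos (k + 1)
      have hxγ : S (h' (n + 1)) k ≤ γ := (hS1.1 k).2
      -- x_k ≤ 2 x_{k+1}
      have hΦk : 1 / S (h' (n + 1)) (k + 1) ^ 2 - 1 / S (h' (n + 1)) k ^ 2 ≤ 1 / S (h' (n + 1)) k ^ 2 := by
        have e1 : 1 / S (h' (n + 1)) (k + 1) ^ 2 - 1 / S (h' (n + 1)) k ^ 2 = B (fun i => S (h' (n + 1)) (k + 1 + i)) := by
          rw [hS1.2.2 k]; ring
        have hdec : B (fun i => S (h' (n + 1)) (k + 1 + i)) ≤ B (fun i => S (h' (n + 1)) (0 + 1 + i)) :=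
          hmono _ _ (seqBox_shift hS1.1 (k + 1)) (seqBox_shift hS1.1 (0 + 1)) fun i => hxanti (by omega)
        have e0 : (fun i => S (h' (n + 1)) (0 + 1 + i)) = (fun i => S (h' (n + 1)) (1 + i)) := by funext i; simp
        rw [e0] at hdec
        have hlev : 1 / u1 ≤ 1 / S (h' (n + 1)) k ^ 2 := by
          simp only [hu1]; exact one_div_le_one_div_of_le (pow_pos hxk 2) (pow_le_pow_left₀ hxk.le (hxle0 k) 2)
        rw [e1]; linarith [hdec.trans hΦ00]
      have h2x : S (h' (n + 1)) k ≤ 2 * S (h' (n + 1)) (k + 1) := by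
        have hsq : S (h' (n + 1)) k ^ 2 ≤ (2 * S (h' (n + 1)) (k + 1)) ^ 2 := by
          have h4 : 1 / S (h' (n + 1)) (k + 1) ^ 2 ≤ 4 * (1 / S (h' (n + 1)) k ^ 2) := by
            have : 0 < 1 / S (h' (n + 1)) k ^ 2 := by positivity
            linarith
          have := mul_le_mul_of_nonneg_left h4 (by positivity : (0:ℝ) ≤ S (h' (n + 1)) k ^ 2 * S (h' (n + 1)) (k + 1) ^ 2)
          have e1 : S (h' (n + 1)) k ^ 2 * S (h' (n + 1)) (k + 1) ^ 2 * (1 / S (h' (n + 1)) (k + 1) ^ 2) = S (h' (n + 1)) k ^ 2 := by field_simp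
          have e2 : S (h' (n + 1)) k ^ 2 * S (h' (n + 1)) (k + 1) ^ 2 * (4 * (1 / S (h' (n + 1)) k ^ 2)) = (2 * S (h' (n + 1)) (k + 1)) ^ 2 := by
            field_simp; ring
          rw [e1, e2] at this; exact this
        exact (pow_le_pow_iff_left₀ hxk.le (by positivity) two_ne_zero).mp hsq
      have hr := hfratio k (S (h' (n + 1)) (k + 1)) (S (h' (n + 1)) k) hxk1 (hxanti (Nat.le_succ k)) hxγ
      -- f(x_k)·x_{k+1} ≤ f(x_{k+1})·x_k ≤ f(x_{k+1})·2x_{k+1}  ⟹  f(x_k) ≤ 2 f(x_{k+1})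
      have hf1 := hf0 k (S (h' (n + 1)) (k + 1)) hxk1 ((hxanti (Nat.le_succ k)).trans hxγ)
      have hfx2 : f k (S (h' (n + 1)) k) ≤ 2 * f k (S (h' (n + 1)) (k + 1)) := by
        have h1 : f k (S (h' (n + 1)) k) * S (h' (n + 1)) (k + 1) ≤ 2 * f k (S (h' (n + 1)) (k + 1)) * S (h' (n + 1)) (k + 1) := by
          nlinarith [mul_le_mul_of_nonneg_left h2x hf1]
        exact le_of_mul_le_mul_right h1 hxk1
      rw [show 1 + k = k + 1 by ring]
      nlinarith [hlx, hfx2, hl0]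
    have e : ∑ k ∈ range K, f k (S (h' (n + 1)) (1 + k)) = B (fun i => S (h' (n + 1)) (1 + i)) - β₀ := by
      rw [hBf _ (fun i => hS1.1 (1 + i))]; ring
    rw [e] at hle
    have h1 := mul_le_mul_of_nonneg_left hle hu1p.le
    have h2 := mul_le_mul_of_nonneg_left hΦ00 hu1p.le
    rw [mul_one_div_cancel hu1p.ne'] at h2
    nlinarith [mul_pos hu1p hβ]
  -- the row condition: λ(σ²x/2) + u0·λ·x/2 ≤ u0·λ·x ≤ u0·f(x) ≤ u0·f(σ)
  have hle1 : h' (n + 1) ≤ S (h' n) 1 := by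
    have hσ1 := (hSn.1 1).1
    refine (pow_le_pow_iff_left₀ (hpos (n + 1)).le hσ1.le two_ne_zero).mp
      ((one_div_le_one_div (pow_pos hσ1 2) (pow_pos (hpos (n + 1)) 2)).mp ?_)
    have : 0 ≤ 1 / h' (n + 1) ^ 2 - 1 / h' n ^ 2 - B (fun i => S (h' n) (1 + i)) := by rw [← hlev0]; exact hX0
    have e2 : 1 / S (h' n) (0 + 1) ^ 2 = 1 / S (h' n) 0 ^ 2 + B (fun i => S (h' n) (0 + 1 + i)) := hSn.2.2 0
    rw [family_zero hS hpn.1 hpn.2] at e2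
    have e3 : (fun i => S (h' n) (0 + 1 + i)) = (fun i => S (h' n) (1 + i)) := by funext i; simp
    rw [e3] at e2; simp only [Nat.zero_add] at e2
    linarith
  have hcond : ∑ k ∈ range K, lam k * (S (h' n) (1 + k) ^ 2 * S (h' (n + 1)) k / 2) + u0 * C
      ≤ u0 * ∑ k ∈ range K, f k (S (h' n) (1 + k)) := by
    rw [hC, mul_sum, mul_sum, ← sum_add_distrib]
    refine sum_le_sum fun k _ => ?_
    obtain ⟨hl0, _, hlx⟩ := hlamk k
    have hxk := hxpos k
    have hσ := (hSn.1 (1 + k)).1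
    have hσγ := (hSn.1 (1 + k)).2
    obtain ⟨hρ0, _⟩ := dual_two_pin_le hb hmono hB hM hlo hS huniq hh' n hle1 k
    have hθ : S (h' n) (1 + k) ^ 2 ≤ u0 := by
      have : S (h' n) (1 + k) ≤ S (h' n) 0 := hσanti (Nat.zero_le _)
      rw [family_zero hS hpn.1 hpn.2] at this
      exact pow_le_pow_left₀ hσ.le this 2
    have h1 : S (h' n) (1 + k) ^ 2 * S (h' (n + 1)) k / 2 ≤ u0 * S (h' (n + 1)) k / 2 := by
      have := mul_le_mul_of_nonneg_right hθ hxk.le; linarith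
    have hfx : lam k * S (h' (n + 1)) k ≤ f k (S (h' n) (1 + k)) := hlx.trans (hfmono k _ _ hxk (by linarith) hσγ)
    have := mul_le_mul_of_nonneg_left h1 hl0
    nlinarith [mul_le_mul_of_nonneg_left hfx hu0p.le]
  have hSg : ∑ k ∈ range K, f k (S (h' n) (1 + k)) = B (fun i => S (h' n) (1 + i)) - β₀ := by
    rw [hBf _ (fun i => hSn.1 (1 + i))]; ring
  have hΦ0 : B (fun i => S (h' n) (1 + i)) ≤ 1 / u1 - 1 / u0 := by rw [hlev0] at hX0; simp only [hu0, hu1]; linarith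
  exact gauge_of_row hu0p hu1p hβ hX0 hrow hdef hC1 hcond hSg hΦ0

/-! ## §2 The induction and the comparison theorem for separable concave memory -/

/-- **THE DUAL LEVEL GAUGE ALONG EVERY PERTURBED ORBIT (separable concave memory).**  At EVERY row `m`: `X′_m ≥ 0` and `X′_{m+1}·h′_{m+1}² ≤ X′_m·h′_m²` — induction from the
depth of (E135b) `exists_depth` (with `C₀ = (M∕b)³`, so that the pins are deep in the sense `M·h′ ≤ b`) upward: `concave_deep_step` at the base, (E136b) `concave_gauge_step`
at the step. [folklore] -/
theorem concave_steps_nonneg_gauge {M' : ℝ} (hBf : ∀ u, SeqBox γ u → B u = β₀ + ∑ k ∈ range K, f k (u k)) (hβ : 0 < β₀)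
    (hf0 : ∀ k a, 0 < a → a ≤ γ → 0 ≤ f k a) (hfratio : ∀ k a c, 0 < a → a ≤ c → c ≤ γ → f k c * a ≤ f k a * c)
    (hfconc : ∀ k a c d e, 0 < a → a < c → 0 < d → d < e → a ≤ d → c ≤ e → e ≤ γ → (f k e - f k d) * (c - a) ≤ (f k c - f k a) * (e - d))
    (hfmono : ∀ k a c, 0 < a → a ≤ c → c ≤ γ → f k a ≤ f k c)
    (hb : 0 < b)
    (hmono : ∀ u v : ℕ → ℝ, SeqBox γ u → SeqBox γ v → (∀ i, u i ≤ v i) → B u ≤ B v)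
    (hB : ∀ u u' : ℕ → ℝ, SeqBox γ u → SeqBox γ u' → ∀ D : ℝ, (∀ j, |u j - u' j| ≤ D) → |B u - B u'| ≤ M * D) (hM : 0 ≤ M)
    (hlo : ∀ u, SeqBox γ u → b ≤ B u)
    (hS : ∀ p, 0 < p → p ≤ γ → SeqBox γ (S p) ∧ MemFlow B p (S p))
    (huniq : ∀ p, 0 < p → p ≤ γ → ∀ u u' : ℕ → ℝ, SeqBox γ u → SeqBox γ u' → MemFlow B p u → MemFlow B p u' → u = u')
    (hB' : ∀ u u' : ℕ → ℝ, SeqBox γ u → SeqBox γ u' → ∀ D : ℝ, (∀ j, |u j - u' j| ≤ D) → |B' u - B' u'| ≤ M' * D) (hM' : 0 ≤ M')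
    (hexc : ∀ u, SeqBox γ u → B u ≤ B' u)
    (hDmono : ∀ u v : ℕ → ℝ, SeqBox γ u → SeqBox γ v → (∀ i, u i ≤ v i) → B' u - B u ≤ B' v - B v)
    (hh' : SeqBox γ h') {y : ℝ} (hf' : MemFlow B' y h') :
    ∀ m, 0 ≤ B' (fun i => h' (m + 1 + i)) - B (fun i => S (h' m) (1 + i))
      ∧ (B' (fun i => h' (m + 1 + 1 + i)) - B (fun i => S (h' (m + 1)) (1 + i))) * h' (m + 1) ^ 2
        ≤ (B' (fun i => h' (m + 1 + i)) - B (fun i => S (h' m) (1 + i))) * h' m ^ 2 := by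
  have hpos : ∀ j, 0 < h' j := fun j => (hh' j).1
  have hC₀ : 0 ≤ (M / b) ^ 3 := by positivity
  obtain ⟨N, hN⟩ := exists_depth (S := S) hb hmono hB hM hlo hS hB' hM' hexc hDmono hh' hf' hC₀
  -- (M/b)³·h³ ≤ 1 ⟹ M·h ≤ b
  have hdeepN : ∀ m, N ≤ m → M * h' (m + 1) ≤ b := by
    intro m hm
    have h1 := (hN m hm).1
    have ht0 : 0 ≤ M / b * h' (m + 1) := by have := hpos (m + 1); positivity
    have h2 : (M / b * h' (m + 1)) ^ 3 ≤ 1 := by rw [mul_pow]; exact h1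
    have h3 : M / b * h' (m + 1) ≤ 1 := (pow_le_one_iff_of_nonneg ht0 (by norm_num)).mp h2
    rw [div_mul_eq_mul_div, div_le_one hb] at h3
    exact h3
  have hP : ∀ d n, N ≤ n + d → ∀ m, n ≤ m → 0 ≤ B' (fun i => h' (m + 1 + i)) - B (fun i => S (h' m) (1 + i))
      ∧ (B' (fun i => h' (m + 1 + 1 + i)) - B (fun i => S (h' (m + 1)) (1 + i))) * h' (m + 1) ^ 2
        ≤ (B' (fun i => h' (m + 1 + i)) - B (fun i => S (h' m) (1 + i))) * h' m ^ 2 := by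
    intro d
    induction d with
    | zero =>
      intro n hn m hm
      rw [add_zero] at hn
      have hXm := (hN m (hn.trans hm)).2
      refine ⟨hXm, ?_⟩
      exact concave_deep_step (B' := B') hBf hβ hf0 hfratio hfconc hfmono hb hmono hB hM hlo hS huniq hexc hDmono hh' hf' m hXm
        (fun l => (hN (m + 1 + l) (by omega)).2) (hdeepN m (hn.trans hm))
    | succ d ih =>
      intro n hn m hm
      have ih' := ih (n + 1) (by omega)
      by_cases hm1 : n + 1 ≤ m
      · exact ih' m hm1
      · have hmn : m = n := by omega
        subst hmn
        exact concave_gauge_step (B' := B') hBf hβ hf0 hfratio hfconc hfmono hb hmono hB hM hlo hS huniq hexc hDmono hh' hf' m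
          (fun l => (ih' (m + 1 + l) (by omega)).1) (fun m' hm' => (ih' m' hm').2)
  intro m
  exact hP N 0 (by omega) m (Nat.zero_le m)

/-- **COMPARISON AT ANY SIZE FOR EVERY ISOTONE EXCESS OVER A SEPARABLE CONCAVE MEMORY (family-free).**  `B u = β₀ + Σ_{k<K} f_k(u_k)` on the box ]0,γ] with `β₀ > 0` and, for
every age `k`: `f_k ≥ 0`, `f_k` NON-DECREASING, `f_k(u)∕u` NON-INCREASING and `f_k` CONCAVE on ]0,γ] (chord slopes non-increasing in both endpoints) — the affine memory
`f_k(u) = L_k u` is the boundary case; `B` with a zeroth moment `M`; `B′ ≥ B` with a zeroth moment and ISOTONE excess (no modulus, steepness, size or threshold condition);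
`h`, `h′` ANY box solutions of `B`, `B′` from one pin.  Then `h′ ≤ h` at EVERY scale.  The hinge memory of (E56a) (comparison FAILS, constant excess) is exactly
non-concave: with (E135b) this brackets the class of memories for which isotone excesses compare. [folklore] -/
theorem le_of_isotone_excess_concave {M' p : ℝ} {h : ℕ → ℝ} (hBf : ∀ u, SeqBox γ u → B u = β₀ + ∑ k ∈ range K, f k (u k)) (hβ : 0 < β₀)
    (hf0 : ∀ k a, 0 < a → a ≤ γ → 0 ≤ f k a) (hfmono : ∀ k a c, 0 < a → a ≤ c → c ≤ γ → f k a ≤ f k c)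
    (hfratio : ∀ k a c, 0 < a → a ≤ c → c ≤ γ → f k c * a ≤ f k a * c)
    (hfconc : ∀ k a c d e, 0 < a → a < c → 0 < d → d < e → a ≤ d → c ≤ e → e ≤ γ → (f k e - f k d) * (c - a) ≤ (f k c - f k a) * (e - d))
    (hB : ∀ u u' : ℕ → ℝ, SeqBox γ u → SeqBox γ u' → ∀ D : ℝ, (∀ j, |u j - u' j| ≤ D) → |B u - B u'| ≤ M * D) (hM : 0 ≤ M)
    (hB' : ∀ u u' : ℕ → ℝ, SeqBox γ u → SeqBox γ u' → ∀ D : ℝ, (∀ j, |u j - u' j| ≤ D) → |B' u - B' u'| ≤ M' * D) (hM' : 0 ≤ M')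
    (hexc : ∀ u, SeqBox γ u → B u ≤ B' u)
    (hDmono : ∀ u v : ℕ → ℝ, SeqBox γ u → SeqBox γ v → (∀ j, u j ≤ v j) → B' u - B u ≤ B' v - B v)
    (hp : 0 < p) (hpγ : p ≤ γ) (hh : SeqBox γ h) (hf : MemFlow B p h) (hh' : SeqBox γ h') (hf' : MemFlow B' p h') (j : ℕ) :
    h' j ≤ h j := by
  -- the separable memory: isotone with floor β₀
  have hmono : ∀ u v : ℕ → ℝ, SeqBox γ u → SeqBox γ v → (∀ i, u i ≤ v i) → B u ≤ B v := fun u v hu hv hle => by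
    rw [hBf u hu, hBf v hv]
    exact add_le_add le_rfl (sum_le_sum fun k _ => hfmono k _ _ (hu k).1 (hle k) (hv k).2)
  have hlo : ∀ u, SeqBox γ u → β₀ ≤ B u := fun u hu => by
    rw [hBf u hu]; exact le_add_of_nonneg_right (sum_nonneg fun k _ => hf0 k _ (hu k).1 (hu k).2)
  -- the unique base family
  have hex : ∀ q : ℝ, 0 < q → q ≤ γ → ∃ k : ℕ → ℝ, SeqBox γ k ∧ MemFlow B q k :=
    fun q hq hqγ => Summit.QuantumFields.BalabanUV.Beta.EriceRemainderEnclosureHistoryAutonomyExistence.exists_memFlow_zm hB hM hq hqγ hβ hlo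
  choose! S hSb hSf using hex
  have hS : ∀ q, 0 < q → q ≤ γ → SeqBox γ (S q) ∧ MemFlow B q (S q) := fun q hq hqγ => ⟨hSb q hq hqγ, hSf q hq hqγ⟩
  have huniq : ∀ q, 0 < q → q ≤ γ → ∀ u u' : ℕ → ℝ, SeqBox γ u → SeqBox γ u' → MemFlow B q u → MemFlow B q u' → u = u' :=
    fun q hq _ u u' hu hu' hfu hfu' =>
      Summit.QuantumFields.BalabanUV.Beta.EriceRemainderEnclosureHistoryAutonomyMonotoneGeneral.memFlow_unique_of_monotone_zm hmono hB hM hq hβ hlo hu hu' hfu hfu'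
  have e : h = S p := huniq p hp hpγ _ _ hh (hS p hp hpγ).1 hf (hS p hp hpγ).2
  have hX := concave_steps_nonneg_gauge (B' := B') hBf hβ hf0 hfratio hfconc hfmono hβ hmono hB hM hlo hS huniq hB' hM' hexc hDmono hh' hf'
  rw [e]
  exact cmp_of_dual_steps_nonneg (B' := B') hβ hB hM hlo hS huniq hp hpγ hh' hf' j (fun i _ => sub_nonneg.mp (hX i).1) j le_rfl

end Summit.QuantumFields.BalabanUV.Beta.EriceRemainderEnclosureHistoryAutonomyComparisonDualConcave

end
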